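import Summits.HodgeConjecture.CorCM.Census.CentralSquaresDihedralQuotient
import Summits.HodgeConjecture.CorCM.Census.HalfParityStabiliser

/-!
# The square-central class, XI: the fibre of the dihedral quotient rows — `φ₂ = β − 2`, hence `μ(G, c) = β(G, c) − 2`

COR-CM (cell `pub-hodgecm2`), count-neutral kernel combinatorics by the binder seat b09 (gen 45; lane SQUARE-CENTRAL CLASS, part XI), on part X
(`isLeast_card_gfaces_generate_of_dihedral_quotient`) and gen 31ʼs `𝒦`-criterion of the half-parity lane
(`HalfParity.fibreTwo_add_one_add_wdelta_eq_card_block_of_forall_exists_not_stab_le`, `BlockParity.wdelta_eq_one_iff`), BY NAME.  Theorems only; small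
`decide`s on `D₄`; no certificate, no named fact, no `sorry`.  HONEST FRAMING: `HC_CM` is NOT proved, here or anywhere in the tree; nothing here is a
period or a headline.

For a finite `2`-group `G` with a central involution `c`, a surjection `π : G →* D₄` with `π c = r²` and an involution `q` over `s`:
* §1 `wdelta_eq_one_of_dihedral_quotient`: `δ(G, c) = 1` (the group is not cyclic, so `g^{|G|/2} = 1` for all `g`);
* §2 `fibreTwo_add_two_eq_card_block_of_dihedral_quotient`: **`φ₂(G, c) + 2 = β(G, c)`** — no index-two subgroup containing `c` contains every stabiliser:
  `ker π` and a lift of `sr` stabilise `T₀ = π⁻¹{1, r, s, sr}`, and `q` stabilises the transversal type with deviation set `π⁻¹(r)`;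
* §3 **`μ(G, c) = β(G, c) − 2`** (`isLeast_card_gfaces_generate_of_dihedral_quotient_block`, with `|ker π| ≥ 4`): the census row of the dihedral quotient
  groups (in particular `D₄ × E`, `|E| = 2ᵏ ≥ 4`) reads «EXACTLY `β − 2` generating faces».

## References
* [Pohlmann1968] H. Pohlmann, Algebraic cycles on abelian varieties of complex multiplication type, Ann. of Math. 88 (1968), Thm 1.
* [Milne1999] J. S. Milne, Lefschetz motives and the Tate conjecture, Compositio Math. 117 (1999), Prop. 2.1, p. 54.
-/

namespace Summit.HodgeConjecture.CorCM.Census.CentralSquares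

open Finset DihedralGroup
open Summit.HodgeConjecture.CorCM.Prior.AllgGroup.RfwfAllgGroup
open Summit.HodgeConjecture.CorCM.Census.BlockParity
open Summit.HodgeConjecture.CorCM.Census.Coinvariant
open Summit.HodgeConjecture.CorCM.Census.TwistGeneration
open Summit.HodgeConjecture.CorCM.Census.BaseBlock

noncomputable section

variable {G : Type*} [Group G] [Fintype G] [DecidableEq G]

/-- `X₀·sr = X₀`: the lift of `sr` stabilises the base type. [folklore] -/
theorem dihedral_stab_sr : ∀ x : DihedralGroup 4,
    x * sr 1 ∈ ({r 0, r 1, sr 0, sr 1} : Finset (DihedralGroup 4)) ↔ x ∈ ({r 0, r 1, sr 0, sr 1} : Finset (DihedralGroup 4)) := by decide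

/-! ## §1 The weight parity is block-constant -/

/-- **`δ = 1`**: in a finite `2`-group mapping onto `D₄` every element satisfies `g^{|G|/2} = 1` (the group is not cyclic). [folklore] -/
theorem wdelta_eq_one_of_dihedral_quotient {c : G} (hG : IsPGroup 2 G) (hc2 : c * c = 1) (hc1 : c ≠ 1) (hcen : ∀ x : G, x * c = c * x)
    (π : G →* DihedralGroup 4) (hπ : Function.Surjective π) (T₀ : CMF G c) : wdelta c T₀ = 1 := by
  rw [wdelta_eq_one_iff c hc2 hc1 hcen T₀]
  obtain ⟨a, ha⟩ := hG.exists_card_eq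
  rw [Nat.card_eq_fintype_card] at ha
  -- `G` is not cyclic: the lifts of `s` and `sr` do not commute
  have hnc : ¬ IsCyclic G := by
    intro hcyc
    haveI := hcyc
    obtain ⟨x, hx⟩ := hπ (sr 0)
    obtain ⟨y, hy⟩ := hπ (sr 1)
    have hcomm : x * y = y * x := (IsCyclic.isMulCommutative (α := G)).is_comm.comm x y
    have h := congrArg π hcomm
    rw [map_mul, map_mul, hx, hy] at h
    exact absurd h (by decide)
  intro g
  have hdvd : orderOf g ∣ 2 ^ a := ha ▸ orderOf_dvd_card
  obtain ⟨b, hb, hob⟩ := (Nat.dvd_prime_pow Nat.prime_two).mp hdvd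
  have hba : b < a := by
    rcases Nat.lt_or_ge b a with h | h
    · exact h
    · exfalso
      have hb' : b = a := le_antisymm hb h
      rw [hb'] at hob
      exact hnc (isCyclic_of_orderOf_eq_card g (by rw [← Nat.card_eq_fintype_card] at ha; rw [hob, ha]))
  have hdiv : orderOf g ∣ Fintype.card G / 2 := by
    rw [ha, hob]
    obtain ⟨d, hd⟩ := Nat.exists_eq_add_of_lt hba
    rw [hd, show b + d + 1 = (b + d) + 1 from rfl, pow_succ, Nat.mul_div_cancel _ (by norm_num : 0 < 2), pow_add]
    exact Dvd.intro _ rfl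
  exact orderOf_dvd_iff_pow_eq_one.mp hdiv

/-! ## §2 No index-two subgroup containing `c` contains every stabiliser -/

/-- **`φ₂ + 2 = β` for the dihedral quotient rows.** [folklore] -/
theorem fibreTwo_add_two_eq_card_block_of_dihedral_quotient {c : G} (hG : IsPGroup 2 G) (hc2 : c * c = 1)
    (hcen : ∀ x : G, x * c = c * x) (π : G →* DihedralGroup 4) (hπ : Function.Surjective π) (hπc : π c = r 2)
    (q : G) (hπq : π q = sr 0) :
    fibreTwo c hc2 + 2 = Fintype.card (Block c) := by
  classical
  have hc1 : c ≠ 1 := by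
    intro h; rw [h, map_one] at hπc; exact absurd hπc (by decide)
  set X₀ : Finset (DihedralGroup 4) := {r 0, r 1, sr 0, sr 1} with hX₀
  let T₀ : CMF G c := ⟨univ.filter fun g : G => π g ∈ X₀, isCMF_comap π hπc⟩
  have hT₀mem : ∀ P : G, P ∈ T₀.1 ↔ π P ∈ X₀ := fun P => by
    change P ∈ univ.filter (fun g : G => π g ∈ X₀) ↔ _; rw [mem_filter]; simp only [mem_univ, true_and]
  have hrtmem : ∀ (R P : G), P ∈ (rt c R T₀).1 ↔ π P * π R ∈ X₀ := fun R P => by rw [mem_rt, hT₀mem, map_mul]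
  have hδ := wdelta_eq_one_of_dihedral_quotient hG hc2 hc1 hcen π hπ T₀
  suffices h : fibreTwo c hc2 + 1 + wdelta c T₀ = Fintype.card (Block c) by rw [hδ] at h; omega
  refine HalfParity.fibreTwo_add_one_add_wdelta_eq_card_block_of_forall_exists_not_stab_le c hc2 hc1 hcen (fun H hH hcH => ?_) T₀
  -- the kernel stabilises `T₀`
  have hker : ∀ n : G, π n = 1 → rt c n T₀ = T₀ := fun n hn =>
    Subtype.ext (Finset.ext fun P => by rw [hrtmem, hn, mul_one, hT₀mem])
  by_cases hN : ∀ n : G, π n = 1 → n ∈ H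
  · -- `H ⊇ ker π`: then `H = π⁻¹(H̄)` cannot contain both a lift of `s` and a lift of `sr`
    obtain ⟨g₁, hg₁⟩ := hπ (sr 1)
    by_cases hq : q ∈ H
    · -- the lift of `sr` stabilises `T₀` and lies outside `H`
      refine ⟨T₀, fun hle => ?_⟩
      have hstab : g₁ ∈ HalfParity.stab c T₀ := by
        rw [HalfParity.mem_stab]
        exact Subtype.ext (Finset.ext fun P => by rw [hrtmem, hg₁, hT₀mem]; exact dihedral_stab_sr (π P))
      have hg₁H : g₁ ∈ H := hle hstab
      -- then `π(H) ∋ s, sr`, so `r = s · sr ∈ π(H)` and every element of `G` lies in `H`: index `1`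
      have hall : ∀ x : G, x ∈ H := by
        intro x
        -- write `π x` as a word in `s, sr` and lift along the kernel
        have hgen : ∀ d : DihedralGroup 4, d = 1 ∨ d = sr 0 ∨ d = sr 1 ∨ d = sr 0 * sr 1 ∨ d = sr 1 * sr 0 ∨
            d = sr 0 * sr 1 * sr 0 ∨ d = sr 1 * sr 0 * sr 1 ∨ d = sr 0 * sr 1 * sr 0 * sr 1 := by decide
        have hlift : ∃ y ∈ H, π y = π x := by
          rcases hgen (π x) with h | h | h | h | h | h | h | h
          · exact ⟨1, H.one_mem, by rw [map_one, h]⟩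
          · exact ⟨q, hq, by rw [hπq, h]⟩
          · exact ⟨g₁, hg₁H, by rw [hg₁, h]⟩
          · exact ⟨q * g₁, H.mul_mem hq hg₁H, by rw [map_mul, hπq, hg₁, h]⟩
          · exact ⟨g₁ * q, H.mul_mem hg₁H hq, by rw [map_mul, hπq, hg₁, h]⟩
          · exact ⟨q * g₁ * q, H.mul_mem (H.mul_mem hq hg₁H) hq, by rw [map_mul, map_mul, hπq, hg₁, h]⟩
          · exact ⟨g₁ * q * g₁, H.mul_mem (H.mul_mem hg₁H hq) hg₁H, by rw [map_mul, map_mul, hπq, hg₁, h]⟩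
          · exact ⟨q * g₁ * q * g₁, H.mul_mem (H.mul_mem (H.mul_mem hq hg₁H) hq) hg₁H,
              by rw [map_mul, map_mul, map_mul, hπq, hg₁, h]⟩
        obtain ⟨y, hy, hyx⟩ := hlift
        have hn : π (y⁻¹ * x) = 1 := by rw [map_mul, map_inv, hyx, inv_mul_cancel]
        have h := H.mul_mem hy (hN _ hn)
        rwa [mul_inv_cancel_left] at h
      have htop : H = ⊤ := (Subgroup.eq_top_iff' H).mpr hall
      rw [htop, Subgroup.index_top] at hH
      exact absurd hH (by norm_num)
    · -- `q ∉ H`: the transversal type with deviation set `π⁻¹(r)` is `q`-stable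
      have hσH : ∀ t ∈ T₀.1, ∀ t' ∈ T₀.1, (t' = t * q ∨ t' = c * (t * q)) →
          (t ∈ T₀.1 \ (rt c q T₀).1 ↔ t' ∈ T₀.1 \ (rt c q T₀).1) := by
        intro t ht t' ht' h
        rw [hT₀mem] at ht ht'
        have h1 : π t' = π t * sr 0 ∨ π t' = r 2 * (π t * sr 0) := by
          rcases h with h | h
          · left; rw [h, map_mul, hπq]
          · right; rw [h, map_mul, map_mul, hπc, hπq]
        have hH' : ∀ P : G, P ∈ T₀.1 \ (rt c q T₀).1 ↔ π P ∈ ({r 1, sr 1} : Finset (DihedralGroup 4)) := fun P => by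
          rw [mem_sdiff, hT₀mem, hrtmem, hπq]; exact dihedral_H (π P)
        rw [hH', hH']
        exact dihedral_sigma_H (π t) (π t') ht ht' h1
      set T : Finset G := univ.filter fun g : G => π g ∈ ({r 1} : Finset (DihedralGroup 4)) with hTdef
      have hTsub : T ⊆ T₀.1 := by
        intro g hg; rw [hTdef, mem_filter] at hg; rw [hT₀mem]
        have h := hg.2; rw [mem_singleton] at h; rw [h]; decide
      obtain ⟨Φ, hΦ⟩ := exists_type_of_dev c hc2 T₀ T hTsub
      have hTH : T ⊆ T₀.1 \ (rt c q T₀).1 := by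
        intro g hg; rw [hTdef, mem_filter] at hg
        rw [mem_sdiff, hT₀mem, hrtmem, hπq]
        have h := hg.2; rw [mem_singleton] at h; rw [h]; decide
      have hT : ∀ t ∈ T₀.1 \ (rt c q T₀).1, ∀ t' ∈ T₀.1, (t' = t * q ∨ t' = c * (t * q)) → (t ∈ T ↔ t' ∉ T) := by
        intro t ht t' ht' h
        have htH : π t ∈ ({r 1, sr 1} : Finset (DihedralGroup 4)) := by
          rw [mem_sdiff, hT₀mem, hrtmem, hπq] at ht; exact (dihedral_H (π t)).mp ht
        rw [hT₀mem] at ht'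
        have h1 : π t' = π t * sr 0 ∨ π t' = r 2 * (π t * sr 0) := by
          rcases h with h | h
          · left; rw [h, map_mul, hπq]
          · right; rw [h, map_mul, map_mul, hπc, hπq]
        obtain ⟨h2, h3, -, -⟩ := dihedral_sigma_val (π t) (π t') (dihedral_sub.1 (π t) htH) ht' h1
        rw [hTdef, mem_filter, mem_filter]; simp only [mem_univ, true_and, mem_singleton]
        have ht2 : π t = r 1 ∨ π t = sr 1 := by rwa [mem_insert, mem_singleton] at htH
        constructor
        · intro e; rw [h2.mp e]; decide
        · intro hne
          rcases ht2 with e | e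
          · exact e
          · exact absurd (h3.mp e) hne
      have hstab : rt c q Φ = Φ :=
        rt_eq_self_of_transversal c T₀ q (T₀.1 \ (rt c q T₀).1) rfl hσH Φ T ∅ (by rw [union_empty]; exact hΦ) hTH
          (empty_subset _) hT (fun t _ t' _ _ => by simp)
      exact ⟨Φ, fun hle => hq (hle ((HalfParity.mem_stab c Φ q).mpr hstab))⟩
  · -- some kernel element lies outside `H`; it stabilises `T₀`
    push Not at hN
    obtain ⟨n, hn, hnH⟩ := hN
    exact ⟨T₀, fun hle => hnH (hle ((HalfParity.mem_stab c T₀ n).mpr (hker n hn)))⟩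

/-! ## §3 The census row: exactly `β − 2` faces -/

/-- **`μ(G, c) = β(G, c) − 2` for the dihedral quotient rows** (`|ker π| ≥ 4`): the least number of faces whose base changes together with the pairs
generate the Hodge lattice is the number of blocks minus two. [folklore] -/
theorem isLeast_card_gfaces_generate_of_dihedral_quotient_block {c : G} (hG : IsPGroup 2 G) (hc2 : c * c = 1)
    (hcen : ∀ x : G, x * c = c * x) (π : G →* DihedralGroup 4) (hπ : Function.Surjective π) (hπc : π c = r 2)
    (hker : 4 ≤ Nat.card π.ker) (q : G) (hπq : π q = sr 0) (hqq : q * q = 1) :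
    IsLeast {n : ℕ | ∃ S : Finset (CMF G c →₀ ℤ), (↑S ⊆ gfaceSet G c hc2) ∧ S.card = n ∧
      hodgeSpan c hc2 ≤ Submodule.span ℤ (pairSet c) ⊔ Submodule.span ℤ (translates c S)} (Fintype.card (Block c) - 2) := by
  have h := fibreTwo_add_two_eq_card_block_of_dihedral_quotient hG hc2 hcen π hπ hπc q hπq
  rw [show Fintype.card (Block c) - 2 = fibreTwo c hc2 by omega]
  exact isLeast_card_gfaces_generate_of_dihedral_quotient hG hc2 hcen π hπ hπc hker q hπq hqq

/-! ## §4 The dihedral factor rows `D₄ × E` -/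

section Prod

variable (E : Type) [Group E] [Fintype E] [DecidableEq E]

/-- **`φ₂ + 2 = β` for `(D₄ × E, (r², 1))`**, `E` any finite group of order `2ᵏ`. [folklore] -/
theorem fibreTwo_add_two_eq_card_block_dihedral_prod (k : ℕ) (hE : Fintype.card E = 2 ^ k) :
    fibreTwo ((r 2, 1) : DihedralGroup 4 × E) (prod_c_mul_c E) + 2 = Fintype.card (Block ((r 2, 1) : DihedralGroup 4 × E)) := by
  classical
  have hG : IsPGroup 2 (DihedralGroup 4 × E) := by
    refine IsPGroup.of_card (n := k + 3) ?_
    rw [Nat.card_eq_fintype_card, Fintype.card_prod, hE, DihedralGroup.card]; ring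
  have hcen : ∀ x : DihedralGroup 4 × E, x * (r 2, 1) = (r 2, 1) * x := by
    intro x; ext
    · change x.1 * r 2 = r 2 * x.1; have h : ∀ d : DihedralGroup 4, d * r 2 = r 2 * d := by decide
      exact h x.1
    · change x.2 * 1 = 1 * x.2; rw [mul_one, one_mul]
  exact fibreTwo_add_two_eq_card_block_of_dihedral_quotient hG (prod_c_mul_c E) hcen (MonoidHom.fst (DihedralGroup 4) E)
    Prod.fst_surjective rfl ((sr 0, 1) : DihedralGroup 4 × E) rfl

/-- **`μ = β − 2` for `(D₄ × E, (r², 1))`**, `E` any finite group of order `2ᵏ ≥ 4`: the census row reads «exactly `β − 2` generating faces».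
[folklore] -/
theorem isLeast_card_gfaces_generate_dihedral_prod_block (k : ℕ) (hk : 2 ≤ k) (hE : Fintype.card E = 2 ^ k) :
    IsLeast {n : ℕ | ∃ S : Finset (CMF (DihedralGroup 4 × E) ((r 2, 1) : DihedralGroup 4 × E) →₀ ℤ),
      (↑S ⊆ gfaceSet (DihedralGroup 4 × E) ((r 2, 1) : DihedralGroup 4 × E) (prod_c_mul_c E)) ∧ S.card = n ∧
      hodgeSpan ((r 2, 1) : DihedralGroup 4 × E) (prod_c_mul_c E) ≤
        Submodule.span ℤ (pairSet ((r 2, 1) : DihedralGroup 4 × E)) ⊔ Submodule.span ℤ (translates ((r 2, 1) : DihedralGroup 4 × E) S)}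
      (Fintype.card (Block ((r 2, 1) : DihedralGroup 4 × E)) - 2) := by
  have h := fibreTwo_add_two_eq_card_block_dihedral_prod E k hE
  rw [show Fintype.card (Block ((r 2, 1) : DihedralGroup 4 × E)) - 2 = fibreTwo ((r 2, 1) : DihedralGroup 4 × E) (prod_c_mul_c E) by
    omega]
  exact isLeast_card_gfaces_generate_dihedral_prod E k hk hE

end Prod

/-! ## §5 Unconditional forms: every dihedral quotient row has `φ₂ = β − 2` and `μ ≥ β − 2` -/

/-- **`φ₂ + 2 = β` for EVERY dihedral quotient row**: `G` a finite `2`-group, `c` a central involution, `π : G ↠ D₄` with `π c = r²` — no kernel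
bound and no involution over `s` are needed (a lift of `s` exists by surjectivity). [folklore] -/
theorem fibreTwo_add_two_eq_card_block_of_dihedral_quotient' {c : G} (hG : IsPGroup 2 G) (hc2 : c * c = 1)
    (hcen : ∀ x : G, x * c = c * x) (π : G →* DihedralGroup 4) (hπ : Function.Surjective π) (hπc : π c = r 2) :
    fibreTwo c hc2 + 2 = Fintype.card (Block c) := by
  obtain ⟨q, hq⟩ := hπ (sr 0)
  exact fibreTwo_add_two_eq_card_block_of_dihedral_quotient hG hc2 hcen π hπ hπc q hq

/-- **`μ ≥ β − 2` for EVERY dihedral quotient row** (the coinvariant floor `μ ≥ φ₂` of `Coinvariant.fibreTwo_le_card_of_faces` made explicit):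
every finite family of faces whose translates together with the pairs generate the Hodge lattice has at least `β − 2` members; equality is attained
under the hypotheses of part X (`isLeast_card_gfaces_generate_of_dihedral_quotient_block`). [folklore] -/
theorem card_block_sub_two_mem_lowerBounds_of_dihedral_quotient {c : G} (hG : IsPGroup 2 G) (hc2 : c * c = 1)
    (hcen : ∀ x : G, x * c = c * x) (π : G →* DihedralGroup 4) (hπ : Function.Surjective π) (hπc : π c = r 2) :
    Fintype.card (Block c) - 2 ∈ lowerBounds {n : ℕ | ∃ S : Finset (CMF G c →₀ ℤ), (↑S ⊆ gfaceSet G c hc2) ∧ S.card = n ∧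
      hodgeSpan c hc2 ≤ Submodule.span ℤ (pairSet c) ⊔ Submodule.span ℤ (translates c S)} := by
  rintro n ⟨S, hS, rfl, hgen⟩
  have h := fibreTwo_add_two_eq_card_block_of_dihedral_quotient' hG hc2 hcen π hπ hπc
  have hle : fibreTwo c hc2 ≤ S.card :=
    fibreTwo_le_card_of_faces c hc2 hcen S hS fun x hx => hgen (gfaceSet_subset_hodgeSpan c hc2 hx)
  change Fintype.card (Block c) - 2 ≤ S.card
  omega

end

end Summit.HodgeConjecture.CorCM.Census.CentralSquares
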